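import Mathlib
import Literature.NumberTheory.Irrationality.BrownZudilin2022.CubicalForm
import HarnessLib

/-!
# Brown–Zudilin 2022, Sect. 3: the substitution (8) → (10) PROVED — Literature-side DISCHARGE of `cubicalIntegral_eq_Jintegral`

RE-HOMED into Literature (seat bsd-rank2-lit GEN 14, 2026-08-27; HIDDEN-DISCHARGES sweep, run/shared/lean/pub/bsd-rank2/lit/HIDDEN-DISCHARGES.md):
this file is a verbatim copy of `Summits/KontsevichZagierPeriods/Zeta5Search/CubicalSubstitution.lean` (cell `pub-zeta5`, seat ct-1 g10 —
the authors of the mathematics), namespace `Summit.KontsevichZagierPeriods.Zeta5Search.CubicalSubstitution` ↦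
`Literature.NumberTheory.Irrationality.BrownZudilin2022.CubicalSubstitution`, with the discharge
`Literature.NumberTheory.Irrationality.BrownZudilin2022.cubicalIntegral_eq_Jintegral_holds` declared next to the fact's namespace so that
Literature importers can feed `(h10 : cubicalIntegral_eq_Jintegral)`; cite tags added per decl. Original header follows.

# ζ(5) search — Brown–Zudilin's substitution (8) → (10) PROVED: `cubicalIntegral_eq_Jintegral` holds (cell `pub-zeta5`, seat ct-1 g10)

HONEST FRAMING: systematic search; no irrationality claim unless kernel-certified. Nothing in this file is an irrationality
result, a worthiness exponent or a denominator statement. It DISCHARGES a named Literature fact that the cell's kernel files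
carry as a hypothesis:

* `Literature.NumberTheory.Irrationality.BrownZudilin2022.cubicalIntegral_eq_Jintegral` [BrownZudilin2022, Sect. 3, (10)–(11)]:
  for every parameter vector `a`, the cubical five-variable integral (8) equals the 12-parameter integral `J(p(a); q(a))` of (10).
  The source states it as the result of the substitution `x = ((1−y₁)/(1−y₁y₂), 1−y₁y₂, y₃, 1−y₄y₅, (1−y₅)/(1−y₄y₅))`
  ("transforms the 8-parameter integral `I(a)` into a subfamily of the … 12-parameter integrals"); `CubicalForm.lean` typed the
  statement only. Here it is a THEOREM (`cubicalIntegral_eq_Jintegral_holds`), in fact for ALL `a : Fin 8 → ℤ` with no convergence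
  hypothesis (`cubicalIntegral_eq_Jintegral_all`): both sides are Bochner integrals over the open cube and the change of variables
  (`MeasureTheory.integral_image_eq_integral_abs_det_fderiv_smul`) needs no integrability.

Ingredients, all proved here (theorems only, no new definitions): the substitution `substJ` is a bijection of the open cube
`(0,1)⁵` with inverse `x ↦ (1−x₁x₂, (1−x₂)/(1−x₁x₂), x₃, (1−x₄)/(1−x₄x₅), 1−x₄x₅)` (`substJ_invJ`, `invJ_substJ`, `substJ_image`,
`substJ_injOn`); it is differentiable on the cube with Jacobian determinant `y₁y₅/((1−y₁y₂)(1−y₄y₅)) > 0` (`hasFDerivAt_substJ`; the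
value recorded in the remarks of `CubicalForm.lean`); and the POINTWISE identity
`det · cubicalIntegrand a (substJ y) = integrandJ (p(a)) (q(a)) y` on the cube (`integrand_substJ`), an identity of Laurent
monomials in the fourteen positive atoms `yⱼ, 1−yⱼ, 1−y₁y₂, 1−y₄y₅, 1−y₃(1−y₁y₂), 1−y₃(1−y₄y₅)` proved by comparing logarithms.

Consequence for the tree: the hypothesis `(h10 : cubicalIntegral_eq_Jintegral)` of the gen-1 (H1)-free cellular-relation files
`WedgeDictionaryKernel{Cells,Atlas,Trans}*` can be instantiated by `cubicalIntegral_eq_Jintegral_holds`. The companion fact (8)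
(`cellularIntegral_eq_cubicalIntegral`, simplex → cube) is NOT treated here.
-/

noncomputable section

namespace Literature.NumberTheory.Irrationality.BrownZudilin2022.CubicalSubstitution

open MeasureTheory Set
open ContinuousLinearMap (proj)
open Literature.NumberTheory.Irrationality.BrownZudilin2022

/-! ### The open cube -/

/-- The open cube is the product of five open unit intervals.
[cite: BrownZudilin2022, Sect. 3, (8)–(11) (the substitution x = ((1−y₁)/(1−y₁y₂), 1−y₁y₂, y₃, 1−y₄y₅, (1−y₅)/(1−y₄y₅)))] -/
theorem openCube_eq_pi : openCube = Set.pi Set.univ (fun _ : Fin 5 => Ioo (0 : ℝ) 1) := by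
  ext x; simp [openCube, Set.mem_pi, Set.mem_Ioo]

/-- The open cube is measurable.
[cite: BrownZudilin2022, Sect. 3, (8)–(11) (the substitution x = ((1−y₁)/(1−y₁y₂), 1−y₁y₂, y₃, 1−y₄y₅, (1−y₅)/(1−y₄y₅)))] -/
theorem measurableSet_openCube : MeasurableSet openCube := by
  rw [openCube_eq_pi]
  exact MeasurableSet.univ_pi fun _ => measurableSet_Ioo

/-- Elementary inequalities for `0 < u, v < 1`: `1 − uv`, `(1−u)/(1−uv)` and `(1−v)/(1−uv)` lie in `(0,1)`.
[cite: BrownZudilin2022, Sect. 3, (8)–(11) (the substitution x = ((1−y₁)/(1−y₁y₂), 1−y₁y₂, y₃, 1−y₄y₅, (1−y₅)/(1−y₄y₅)))] -/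
theorem cube_aux {u v : ℝ} (hu : 0 < u) (hu' : u < 1) (hv : 0 < v) (hv' : v < 1) :
    0 < 1 - u * v ∧ 1 - u * v < 1 ∧ 0 < (1 - u) / (1 - u * v) ∧ (1 - u) / (1 - u * v) < 1
      ∧ 0 < (1 - v) / (1 - u * v) ∧ (1 - v) / (1 - u * v) < 1 := by
  have huv : 0 < u * v := mul_pos hu hv
  have d : 0 < 1 - u * v := by nlinarith [mul_lt_of_lt_one_right hu hv']
  refine ⟨d, by linarith, div_pos (by linarith) d, ?_, div_pos (by linarith) d, ?_⟩
  · rw [div_lt_one d]; nlinarith [mul_lt_of_lt_one_right hu hv']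
  · rw [div_lt_one d]; nlinarith [mul_lt_of_lt_one_left hv hu']

/-! ### The inverse substitution and bijectivity on the cube -/

/-- The inverse substitution `x ↦ (1−x₁x₂, (1−x₂)/(1−x₁x₂), x₃, (1−x₄)/(1−x₄x₅), 1−x₄x₅)` maps the open cube into itself.
[cite: BrownZudilin2022, Sect. 3, (8)–(11) (the substitution x = ((1−y₁)/(1−y₁y₂), 1−y₁y₂, y₃, 1−y₄y₅, (1−y₅)/(1−y₄y₅)))] -/
theorem invJ_mem_openCube {x : Fin 5 → ℝ} (hx : x ∈ openCube) :
    ![1 - x 0 * x 1, (1 - x 1) / (1 - x 0 * x 1), x 2, (1 - x 3) / (1 - x 3 * x 4), 1 - x 3 * x 4] ∈ openCube := by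
  have h0 := hx 0; have h1 := hx 1; have h2 := hx 2; have h3 := hx 3; have h4 := hx 4
  obtain ⟨a1, a2, -, -, a5, a6⟩ := cube_aux h0.1 h0.2 h1.1 h1.2
  obtain ⟨b1, b2, b3, b4, -, -⟩ := cube_aux h3.1 h3.2 h4.1 h4.2
  intro i
  fin_cases i
  · exact ⟨a1, a2⟩
  · exact ⟨a5, a6⟩
  · exact h2
  · exact ⟨b3, b4⟩
  · exact ⟨b1, b2⟩

/-- Block identity: `1 − (1−uv)·((1−v)/(1−uv)) = v`.
[cite: BrownZudilin2022, Sect. 3, (8)–(11) (the substitution x = ((1−y₁)/(1−y₁y₂), 1−y₁y₂, y₃, 1−y₄y₅, (1−y₅)/(1−y₄y₅)))] -/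
theorem block_id1 {u v : ℝ} (h : 1 - u * v ≠ 0) : 1 - (1 - u * v) * ((1 - v) / (1 - u * v)) = v := by
  rw [mul_div_cancel₀ _ h]; ring

/-- Block identity: `(1 − (1−uv)) / (1 − (1−uv)·((1−v)/(1−uv))) = u`.
[cite: BrownZudilin2022, Sect. 3, (8)–(11) (the substitution x = ((1−y₁)/(1−y₁y₂), 1−y₁y₂, y₃, 1−y₄y₅, (1−y₅)/(1−y₄y₅)))] -/
theorem block_id2 {u v : ℝ} (hv : v ≠ 0) (h : 1 - u * v ≠ 0) :
    (1 - (1 - u * v)) / (1 - (1 - u * v) * ((1 - v) / (1 - u * v))) = u := by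
  rw [block_id1 h, sub_sub_cancel, mul_div_assoc, div_self hv, mul_one]

/-- Block identity: `1 − ((1−u)/(1−uv))·(1−uv) = u`.
[cite: BrownZudilin2022, Sect. 3, (8)–(11) (the substitution x = ((1−y₁)/(1−y₁y₂), 1−y₁y₂, y₃, 1−y₄y₅, (1−y₅)/(1−y₄y₅)))] -/
theorem block_id3 {u v : ℝ} (h : 1 - u * v ≠ 0) : 1 - (1 - u) / (1 - u * v) * (1 - u * v) = u := by
  rw [div_mul_cancel₀ _ h]; ring

/-- Block identity: `(1 − (1−uv)) / (1 − ((1−u)/(1−uv))·(1−uv)) = v`.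
[cite: BrownZudilin2022, Sect. 3, (8)–(11) (the substitution x = ((1−y₁)/(1−y₁y₂), 1−y₁y₂, y₃, 1−y₄y₅, (1−y₅)/(1−y₄y₅)))] -/
theorem block_id4 {u v : ℝ} (hu : u ≠ 0) (h : 1 - u * v ≠ 0) :
    (1 - (1 - u * v)) / (1 - (1 - u) / (1 - u * v) * (1 - u * v)) = v := by
  rw [block_id3 h, sub_sub_cancel, mul_comm, mul_div_assoc, div_self hu, mul_one]

/-- The inverse substitution is a right inverse of `substJ` on the open cube.
[cite: BrownZudilin2022, Sect. 3, (8)–(11) (the substitution x = ((1−y₁)/(1−y₁y₂), 1−y₁y₂, y₃, 1−y₄y₅, (1−y₅)/(1−y₄y₅)))] -/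
theorem substJ_invJ {x : Fin 5 → ℝ} (hx : x ∈ openCube) :
    substJ ![1 - x 0 * x 1, (1 - x 1) / (1 - x 0 * x 1), x 2, (1 - x 3) / (1 - x 3 * x 4), 1 - x 3 * x 4] = x := by
  have h0 := hx 0; have h1 := hx 1; have h3 := hx 3; have h4 := hx 4
  have d01 : 1 - x 0 * x 1 ≠ 0 := (cube_aux h0.1 h0.2 h1.1 h1.2).1.ne'
  have d34 : 1 - x 3 * x 4 ≠ 0 := (cube_aux h3.1 h3.2 h4.1 h4.2).1.ne'
  have key : substJ ![1 - x 0 * x 1, (1 - x 1) / (1 - x 0 * x 1), x 2, (1 - x 3) / (1 - x 3 * x 4), 1 - x 3 * x 4]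
      = ![x 0, x 1, x 2, x 3, x 4] := by
    simp only [substJ, Matrix.cons_val_zero, Matrix.cons_val_one, Matrix.cons_val]
    rw [block_id2 h1.1.ne' d01, block_id1 d01, block_id4 h3.1.ne' d34, block_id3 d34]
  rw [key]; ext i; fin_cases i <;> simp

/-- The inverse substitution is a left inverse of `substJ` on the open cube.
[cite: BrownZudilin2022, Sect. 3, (8)–(11) (the substitution x = ((1−y₁)/(1−y₁y₂), 1−y₁y₂, y₃, 1−y₄y₅, (1−y₅)/(1−y₄y₅)))] -/
theorem invJ_substJ {y : Fin 5 → ℝ} (hy : y ∈ openCube) :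
    ![1 - substJ y 0 * substJ y 1, (1 - substJ y 1) / (1 - substJ y 0 * substJ y 1), substJ y 2,
      (1 - substJ y 3) / (1 - substJ y 3 * substJ y 4), 1 - substJ y 3 * substJ y 4] = y := by
  have h0 := hy 0; have h1 := hy 1; have h3 := hy 3; have h4 := hy 4
  have d01 : 1 - y 0 * y 1 ≠ 0 := (cube_aux h0.1 h0.2 h1.1 h1.2).1.ne'
  have d34 : 1 - y 3 * y 4 ≠ 0 := (cube_aux h3.1 h3.2 h4.1 h4.2).1.ne'
  have key : ![1 - substJ y 0 * substJ y 1, (1 - substJ y 1) / (1 - substJ y 0 * substJ y 1), substJ y 2,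
      (1 - substJ y 3) / (1 - substJ y 3 * substJ y 4), 1 - substJ y 3 * substJ y 4] = ![y 0, y 1, y 2, y 3, y 4] := by
    simp only [substJ, Matrix.cons_val_zero, Matrix.cons_val_one, Matrix.cons_val]
    rw [block_id4 h0.1.ne' d01, block_id3 d01, block_id2 h4.1.ne' d34, block_id1 d34]
  rw [key]; ext i; fin_cases i <;> simp

/-- **The substitution is onto the cube:** `substJ '' (0,1)⁵ = (0,1)⁵`.
[cite: BrownZudilin2022, Sect. 3, (8)–(11) (the substitution x = ((1−y₁)/(1−y₁y₂), 1−y₁y₂, y₃, 1−y₄y₅, (1−y₅)/(1−y₄y₅)))] -/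
theorem substJ_image : substJ '' openCube = openCube := by
  refine Subset.antisymm ?_ ?_
  · rintro _ ⟨y, hy, rfl⟩; exact substJ_mem_openCube hy
  · intro x hx; exact ⟨_, invJ_mem_openCube hx, substJ_invJ hx⟩

/-- **The substitution is injective on the cube.**
[cite: BrownZudilin2022, Sect. 3, (8)–(11) (the substitution x = ((1−y₁)/(1−y₁y₂), 1−y₁y₂, y₃, 1−y₄y₅, (1−y₅)/(1−y₄y₅)))] -/
theorem substJ_injOn : InjOn substJ openCube := fun y hy y' hy' h => by
  rw [← invJ_substJ hy, ← invJ_substJ hy', h]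

/-! ### The derivative of the substitution and its determinant -/

/-- Derivative of `y ↦ 1 − yᵢyⱼ`.
[cite: BrownZudilin2022, Sect. 3, (8)–(11) (the substitution x = ((1−y₁)/(1−y₁y₂), 1−y₁y₂, y₃, 1−y₄y₅, (1−y₅)/(1−y₄y₅)))] -/
theorem hasFDerivAt_one_sub_mul (y : Fin 5 → ℝ) (i j : Fin 5) :
    HasFDerivAt (fun y : Fin 5 → ℝ => 1 - y i * y j)
      (-(y i • (proj j : (Fin 5 → ℝ) →L[ℝ] ℝ) + y j • (proj i : (Fin 5 → ℝ) →L[ℝ] ℝ))) y :=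
  ((hasFDerivAt_apply (𝕜 := ℝ) i y).mul (hasFDerivAt_apply (𝕜 := ℝ) j y)).const_sub 1

/-- Derivative of `y ↦ (1 − yᵢ)/(1 − yᵢyⱼ)` away from the pole.
[cite: BrownZudilin2022, Sect. 3, (8)–(11) (the substitution x = ((1−y₁)/(1−y₁y₂), 1−y₁y₂, y₃, 1−y₄y₅, (1−y₅)/(1−y₄y₅)))] -/
theorem hasFDerivAt_blockL (y : Fin 5 → ℝ) (i j : Fin 5) (h : 1 - y i * y j ≠ 0) :
    HasFDerivAt (fun y : Fin 5 → ℝ => (1 - y i) / (1 - y i * y j))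
      (((y j - 1) / (1 - y i * y j) ^ 2) • (proj i : (Fin 5 → ℝ) →L[ℝ] ℝ)
          + ((1 - y i) * y i / (1 - y i * y j) ^ 2) • (proj j : (Fin 5 → ℝ) →L[ℝ] ℝ)) y := by
  have hnum : HasFDerivAt (fun y : Fin 5 → ℝ => 1 - y i) (-(proj i : (Fin 5 → ℝ) →L[ℝ] ℝ)) y :=
    (hasFDerivAt_apply (𝕜 := ℝ) i y).const_sub 1
  have hmul := hnum.mul ((hasFDerivAt_inv h).comp y (hasFDerivAt_one_sub_mul y i j))
  refine HasFDerivAt.congr_fderiv (hmul.congr_of_eventuallyEq ?_) ?_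
  · exact Filter.Eventually.of_forall fun z => by simp [div_eq_mul_inv]
  · ext v
    simp
    field_simp
    ring

/-- Derivative of `y ↦ (1 − yⱼ)/(1 − yᵢyⱼ)` away from the pole.
[cite: BrownZudilin2022, Sect. 3, (8)–(11) (the substitution x = ((1−y₁)/(1−y₁y₂), 1−y₁y₂, y₃, 1−y₄y₅, (1−y₅)/(1−y₄y₅)))] -/
theorem hasFDerivAt_blockR (y : Fin 5 → ℝ) (i j : Fin 5) (h : 1 - y i * y j ≠ 0) :
    HasFDerivAt (fun y : Fin 5 → ℝ => (1 - y j) / (1 - y i * y j))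
      (((1 - y j) * y j / (1 - y i * y j) ^ 2) • (proj i : (Fin 5 → ℝ) →L[ℝ] ℝ)
          + ((y i - 1) / (1 - y i * y j) ^ 2) • (proj j : (Fin 5 → ℝ) →L[ℝ] ℝ)) y := by
  have hnum : HasFDerivAt (fun y : Fin 5 → ℝ => 1 - y j) (-(proj j : (Fin 5 → ℝ) →L[ℝ] ℝ)) y :=
    (hasFDerivAt_apply (𝕜 := ℝ) j y).const_sub 1
  have hmul := hnum.mul ((hasFDerivAt_inv h).comp y (hasFDerivAt_one_sub_mul y i j))
  refine HasFDerivAt.congr_fderiv (hmul.congr_of_eventuallyEq ?_) ?_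
  · exact Filter.Eventually.of_forall fun z => by simp [div_eq_mul_inv]
  · ext v
    simp
    field_simp
    ring

/-- Determinant of a `5 × 5` matrix with the block pattern `2 + 1 + 2`.
[cite: BrownZudilin2022, Sect. 3, (8)–(11) (the substitution x = ((1−y₁)/(1−y₁y₂), 1−y₁y₂, y₃, 1−y₄y₅, (1−y₅)/(1−y₄y₅)))] -/
theorem det_pattern (a b c d e f g h : ℝ) :
    Matrix.det !![a, b, 0, 0, 0; c, d, 0, 0, 0; 0, 0, 1, 0, 0; 0, 0, 0, e, f; 0, 0, 0, g, h]
      = (a * d - b * c) * (e * h - f * g) := by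
  have s12 : (Fin.succAbove (1 : Fin 5) (2 : Fin 4)) = 3 := by decide
  have s13 : (Fin.succAbove (1 : Fin 5) (3 : Fin 4)) = 4 := by decide
  simp [Matrix.det_succ_row_zero, Fin.sum_univ_succ, Matrix.submatrix, s12, s13]
  ring

/-- The `2 × 2` minor of the first block: `y₁/(1 − y₁y₂)`.
[cite: BrownZudilin2022, Sect. 3, (8)–(11) (the substitution x = ((1−y₁)/(1−y₁y₂), 1−y₁y₂, y₃, 1−y₄y₅, (1−y₅)/(1−y₄y₅)))] -/
theorem two_by_two (u v : ℝ) (h : 1 - u * v ≠ 0) :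
    (v - 1) / (1 - u * v) ^ 2 * -u - (1 - u) * u / (1 - u * v) ^ 2 * -v = u / (1 - u * v) := by
  have h2 : (1 - u * v) ^ 2 ≠ 0 := pow_ne_zero 2 h
  rw [div_mul_eq_mul_div, div_mul_eq_mul_div, ← sub_div, div_eq_div_iff h2 h]
  ring

/-- The `2 × 2` minor of the last block: `y₅/(1 − y₄y₅)`.
[cite: BrownZudilin2022, Sect. 3, (8)–(11) (the substitution x = ((1−y₁)/(1−y₁y₂), 1−y₁y₂, y₃, 1−y₄y₅, (1−y₅)/(1−y₄y₅)))] -/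
theorem two_by_two' (u v : ℝ) (h : 1 - u * v ≠ 0) :
    -v * ((u - 1) / (1 - u * v) ^ 2) - -u * ((1 - v) * v / (1 - u * v) ^ 2) = v / (1 - u * v) := by
  have h2 : (1 - u * v) ^ 2 ≠ 0 := pow_ne_zero 2 h
  rw [mul_div_assoc', mul_div_assoc', ← sub_div, div_eq_div_iff h2 h]
  ring

/-- **`substJ` is differentiable away from the poles `y₁y₂ = 1`, `y₄y₅ = 1`, with Jacobian determinant
`det D(substJ)(y) = y₁y₅/((1 − y₁y₂)(1 − y₄y₅))`** (the value recorded in the remarks of `CubicalForm.lean`). The derivative is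
the continuous linear map whose rows (block diagonal: `(y₁,y₂)`, `y₃`, `(y₄,y₅)`) are listed in the proof; its matrix in the standard
basis is computed entrywise and its determinant by `det_pattern`.
[cite: BrownZudilin2022, Sect. 3, (8)–(11) (the substitution x = ((1−y₁)/(1−y₁y₂), 1−y₁y₂, y₃, 1−y₄y₅, (1−y₅)/(1−y₄y₅)))] -/
theorem hasFDerivAt_substJ (y : Fin 5 → ℝ) (h01 : 1 - y 0 * y 1 ≠ 0) (h34 : 1 - y 3 * y 4 ≠ 0) :
    ∃ f' : (Fin 5 → ℝ) →L[ℝ] (Fin 5 → ℝ), HasFDerivAt substJ f' y ∧ f'.det = y 0 * y 4 / ((1 - y 0 * y 1) * (1 - y 3 * y 4)) := by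
  refine ⟨ContinuousLinearMap.pi
    ![((y 1 - 1) / (1 - y 0 * y 1) ^ 2) • (proj 0 : (Fin 5 → ℝ) →L[ℝ] ℝ)
        + ((1 - y 0) * y 0 / (1 - y 0 * y 1) ^ 2) • (proj 1 : (Fin 5 → ℝ) →L[ℝ] ℝ),
      -(y 0 • (proj 1 : (Fin 5 → ℝ) →L[ℝ] ℝ) + y 1 • (proj 0 : (Fin 5 → ℝ) →L[ℝ] ℝ)),
      (proj 2 : (Fin 5 → ℝ) →L[ℝ] ℝ),
      -(y 3 • (proj 4 : (Fin 5 → ℝ) →L[ℝ] ℝ) + y 4 • (proj 3 : (Fin 5 → ℝ) →L[ℝ] ℝ)),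
      ((1 - y 4) * y 4 / (1 - y 3 * y 4) ^ 2) • (proj 3 : (Fin 5 → ℝ) →L[ℝ] ℝ)
          + ((y 3 - 1) / (1 - y 3 * y 4) ^ 2) • (proj 4 : (Fin 5 → ℝ) →L[ℝ] ℝ)], ?_, ?_⟩
  · refine hasFDerivAt_pi'' fun k => ?_
    rw [ContinuousLinearMap.proj_pi]
    fin_cases k
    · simpa [substJ] using hasFDerivAt_blockL y 0 1 h01
    · simpa [substJ] using hasFDerivAt_one_sub_mul y 0 1
    · simpa [substJ] using hasFDerivAt_apply (𝕜 := ℝ) (2 : Fin 5) y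
    · simpa [substJ] using hasFDerivAt_one_sub_mul y 3 4
    · simpa [substJ] using hasFDerivAt_blockR y 3 4 h34
  · have hM : LinearMap.toMatrix' ((ContinuousLinearMap.pi
        ![((y 1 - 1) / (1 - y 0 * y 1) ^ 2) • (proj 0 : (Fin 5 → ℝ) →L[ℝ] ℝ)
            + ((1 - y 0) * y 0 / (1 - y 0 * y 1) ^ 2) • (proj 1 : (Fin 5 → ℝ) →L[ℝ] ℝ),
          -(y 0 • (proj 1 : (Fin 5 → ℝ) →L[ℝ] ℝ) + y 1 • (proj 0 : (Fin 5 → ℝ) →L[ℝ] ℝ)),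
          (proj 2 : (Fin 5 → ℝ) →L[ℝ] ℝ),
          -(y 3 • (proj 4 : (Fin 5 → ℝ) →L[ℝ] ℝ) + y 4 • (proj 3 : (Fin 5 → ℝ) →L[ℝ] ℝ)),
          ((1 - y 4) * y 4 / (1 - y 3 * y 4) ^ 2) • (proj 3 : (Fin 5 → ℝ) →L[ℝ] ℝ)
              + ((y 3 - 1) / (1 - y 3 * y 4) ^ 2) • (proj 4 : (Fin 5 → ℝ) →L[ℝ] ℝ)] : (Fin 5 → ℝ) →L[ℝ] (Fin 5 → ℝ)) :
          (Fin 5 → ℝ) →ₗ[ℝ] (Fin 5 → ℝ))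
        = !![(y 1 - 1) / (1 - y 0 * y 1) ^ 2, (1 - y 0) * y 0 / (1 - y 0 * y 1) ^ 2, 0, 0, 0;
             -y 1, -y 0, 0, 0, 0;
             0, 0, 1, 0, 0;
             0, 0, 0, -y 4, -y 3;
             0, 0, 0, (1 - y 4) * y 4 / (1 - y 3 * y 4) ^ 2, (y 3 - 1) / (1 - y 3 * y 4) ^ 2] := by
      ext i j
      rw [LinearMap.toMatrix'_apply]
      fin_cases i <;> fin_cases j <;> simp
    rw [ContinuousLinearMap.det, ← LinearMap.det_toMatrix', hM, det_pattern, two_by_two _ _ h01, two_by_two' _ _ h34,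
      div_mul_div_comm]

/-! ### The pointwise identity of the integrands -/

/-- `1 − u/d = (d − u)/d`.
[cite: BrownZudilin2022, Sect. 3, (8)–(11) (the substitution x = ((1−y₁)/(1−y₁y₂), 1−y₁y₂, y₃, 1−y₄y₅, (1−y₅)/(1−y₄y₅)))] -/
theorem one_sub_div' {u d : ℝ} (hd : d ≠ 0) : 1 - u / d = (d - u) / d := by
  field_simp

/-- **Pointwise identity** (the content of the substitution): for `0 < yⱼ < 1`,
`y₁y₅/((1−y₁y₂)(1−y₄y₅)) · cubicalIntegrand a (substJ y) = integrandJ (p(a)) (q(a)) y`, for EVERY `a : Fin 8 → ℤ`.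
Proof: every base of (8) at `substJ y` is a Laurent monomial in the fourteen positive atoms; compare logarithms (`ring`).
[cite: BrownZudilin2022, Sect. 3, (8)–(11) (the substitution x = ((1−y₁)/(1−y₁y₂), 1−y₁y₂, y₃, 1−y₄y₅, (1−y₅)/(1−y₄y₅)))] -/
theorem integrand_substJ_coord (a : Fin 8 → ℤ) (y0 y1 y2 y3 y4 : ℝ)
    (h0 : 0 < y0) (h0' : y0 < 1) (h1 : 0 < y1) (h1' : y1 < 1) (h2 : 0 < y2) (h2' : y2 < 1)
    (h3 : 0 < y3) (h3' : y3 < 1) (h4 : 0 < y4) (h4' : y4 < 1) :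
    y0 * y4 / ((1 - y0 * y1) * (1 - y3 * y4)) *
        cubicalIntegrand a ![(1 - y0) / (1 - y0 * y1), 1 - y0 * y1, y2, 1 - y3 * y4, (1 - y4) / (1 - y3 * y4)]
      = integrandJ (pOf a) (qOf a) ![y0, y1, y2, y3, y4] := by
  -- positivity of the atoms
  have u0 : 0 < 1 - y0 := by linarith
  have u1 : 0 < 1 - y1 := by linarith
  have u2 : 0 < 1 - y2 := by linarith
  have u3 : 0 < 1 - y3 := by linarith
  have u4 : 0 < 1 - y4 := by linarith
  have p01 : 0 < y0 * y1 := mul_pos h0 h1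
  have p34 : 0 < y3 * y4 := mul_pos h3 h4
  have d01 : 0 < 1 - y0 * y1 := by nlinarith [mul_lt_of_lt_one_right h0 h1']
  have d34 : 0 < 1 - y3 * y4 := by nlinarith [mul_lt_of_lt_one_right h3 h4']
  have D1 : 0 < 1 - y2 * (1 - y0 * y1) := by nlinarith [mul_lt_of_lt_one_right h2 (by linarith : 1 - y0 * y1 < 1)]
  have D2 : 0 < 1 - y2 * (1 - y3 * y4) := by nlinarith [mul_lt_of_lt_one_right h2 (by linarith : 1 - y3 * y4 < 1)]
  -- the substituted bases as monomials in the atoms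
  have R1 : 1 - (1 - y0) / (1 - y0 * y1) = y0 * (1 - y1) / (1 - y0 * y1) := by
    rw [one_sub_div' d01.ne']; congr 1; ring
  have R4 : 1 - (1 - y4) / (1 - y3 * y4) = y4 * (1 - y3) / (1 - y3 * y4) := by
    rw [one_sub_div' d34.ne']; congr 1; ring
  have R2 : 1 - (1 - y0 * y1) = y0 * y1 := by ring
  have R3 : 1 - (1 - y3 * y4) = y3 * y4 := by ring
  have R5 : 1 - (1 - y0) / (1 - y0 * y1) * (1 - y0 * y1) = y0 := by
    rw [div_mul_cancel₀ _ d01.ne']; ring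
  have R6 : 1 - (1 - y0 * y1) * y2 = 1 - y2 * (1 - y0 * y1) := by ring
  have R8 : 1 - (1 - y3 * y4) * ((1 - y4) / (1 - y3 * y4)) = y4 := by
    rw [mul_div_cancel₀ _ d34.ne']; ring
  simp only [cubicalIntegrand, integrandJ, xExp, oneSubExp, linkExp, pOf, qOf, Matrix.cons_val_zero, Matrix.cons_val_one,
    Matrix.cons_val]
  rw [R1, R4, R2, R3, R5, R6, R8]
  -- generalize the atoms
  set v0 := 1 - y0 with hv0
  set v1 := 1 - y1 with hv1
  set v2 := 1 - y2 with hv2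
  set v3 := 1 - y3 with hv3
  set v4 := 1 - y4 with hv4
  set e01 := 1 - y0 * y1 with he01
  set e34 := 1 - y3 * y4 with he34
  set E1 := 1 - y2 * e01 with hE1
  set E2 := 1 - y2 * e34 with hE2
  clear_value v0 v1 v2 v3 v4 e01 e34 E1 E2
  -- both sides are positive: compare logarithms
  refine (Real.log_injOn_pos.eq_iff ?_ ?_).1 ?_
  · rw [Set.mem_Ioi]; positivity
  · rw [Set.mem_Ioi]; positivity
  simp (disch := positivity) only [Real.log_mul, Real.log_div, Real.log_zpow]
  push_cast
  ring

/-- The pointwise identity on the open cube, in the form used by the change of variables: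
`(y₁y₅/((1−y₁y₂)(1−y₄y₅))) · cubicalIntegrand a (substJ y) = integrandJ (p(a)) (q(a)) y`.
[cite: BrownZudilin2022, Sect. 3, (8)–(11) (the substitution x = ((1−y₁)/(1−y₁y₂), 1−y₁y₂, y₃, 1−y₄y₅, (1−y₅)/(1−y₄y₅)))] -/
theorem integrand_substJ (a : Fin 8 → ℤ) {y : Fin 5 → ℝ} (hy : y ∈ openCube) :
    y 0 * y 4 / ((1 - y 0 * y 1) * (1 - y 3 * y 4)) * cubicalIntegrand a (substJ y) = integrandJ (pOf a) (qOf a) y := by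
  have h0 := hy 0; have h1 := hy 1; have h2 := hy 2; have h3 := hy 3; have h4 := hy 4
  have hy' : y = ![y 0, y 1, y 2, y 3, y 4] := by ext i; fin_cases i <;> simp
  conv_rhs => rw [hy']
  exact integrand_substJ_coord a (y 0) (y 1) (y 2) (y 3) (y 4) h0.1 h0.2 h1.1 h1.2 h2.1 h2.2 h3.1 h3.2 h4.1 h4.2

/-! ### The change of variables -/

/-- **(10) for every parameter vector:** `cubicalIntegral a = J(p(a); q(a))` for ALL `a : Fin 8 → ℤ`
(no convergence hypothesis: the change-of-variables formula for the injective differentiable map `substJ` on the measurable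
set `(0,1)⁵`, whose image is `(0,1)⁵`, holds for the Bochner integral unconditionally).
[cite: BrownZudilin2022, Sect. 3, (8)–(11) (the substitution x = ((1−y₁)/(1−y₁y₂), 1−y₁y₂, y₃, 1−y₄y₅, (1−y₅)/(1−y₄y₅)))] -/
theorem cubicalIntegral_eq_Jintegral_all (a : Fin 8 → ℤ) : cubicalIntegral a = Jintegral (pOf a) (qOf a) := by
  -- a derivative at every point (junk `0` off the cube, where nothing is claimed)
  have hex : ∀ y : Fin 5 → ℝ, ∃ f' : (Fin 5 → ℝ) →L[ℝ] (Fin 5 → ℝ), y ∈ openCube →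
      HasFDerivAt substJ f' y ∧ f'.det = y 0 * y 4 / ((1 - y 0 * y 1) * (1 - y 3 * y 4)) := by
    intro y
    by_cases hy : y ∈ openCube
    · obtain ⟨f', hf'⟩ := hasFDerivAt_substJ y (cube_aux (hy 0).1 (hy 0).2 (hy 1).1 (hy 1).2).1.ne'
        (cube_aux (hy 3).1 (hy 3).2 (hy 4).1 (hy 4).2).1.ne'
      exact ⟨f', fun _ => hf'⟩
    · exact ⟨0, fun h => (hy h).elim⟩
  choose f' hf' using hex
  have hderiv : ∀ y ∈ openCube, HasFDerivWithinAt substJ (f' y) openCube y := fun y hy =>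
    (hf' y hy).1.hasFDerivWithinAt
  have hcv := integral_image_eq_integral_abs_det_fderiv_smul volume measurableSet_openCube hderiv substJ_injOn
    (cubicalIntegrand a)
  rw [substJ_image] at hcv
  rw [cubicalIntegral, hcv, Jintegral]
  refine setIntegral_congr_fun measurableSet_openCube fun y hy => ?_
  have h0 := hy 0; have h1 := hy 1; have h3 := hy 3; have h4 := hy 4
  have d01 := (cube_aux h0.1 h0.2 h1.1 h1.2).1
  have d34 := (cube_aux h3.1 h3.2 h4.1 h4.2).1
  rw [(hf' y hy).2, abs_of_pos (div_pos (mul_pos h0.1 h4.1) (mul_pos d01 d34)), smul_eq_mul]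
  exact integrand_substJ a hy


end Literature.NumberTheory.Irrationality.BrownZudilin2022.CubicalSubstitution

namespace Literature.NumberTheory.Irrationality.BrownZudilin2022

open CubicalSubstitution

/-- **Brown–Zudilin (10) holds:** the named fact `cubicalIntegral_eq_Jintegral` of `CubicalForm.lean`
("the substitution transforms the 8-parameter integral `I(a)` [in its cubical form (8)] into a subfamily of the 12-parameter
integrals", `J(p(a); q(a))`) is a theorem. [BrownZudilin2022, Sect. 3, (10)–(11)]
[cite: BrownZudilin2022, Sect. 3, (8)–(11) (the substitution x = ((1−y₁)/(1−y₁y₂), 1−y₁y₂, y₃, 1−y₄y₅, (1−y₅)/(1−y₄y₅)))] -/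
theorem cubicalIntegral_eq_Jintegral_holds : cubicalIntegral_eq_Jintegral :=
  fun a _ => cubicalIntegral_eq_Jintegral_all a

end Literature.NumberTheory.Irrationality.BrownZudilin2022

end
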